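import Summits.KontsevichZagierPeriods.KontsevichZagierPeriods.Theorems.LinRedNormalFormArrangementNormalFormStubRebaseSimplePosOneFibreResidualSub
import Summits.KontsevichZagierPeriods.KontsevichZagierPeriods.Theorems.LinRedNormalFormArrangementNormalFormStubRebaseSimpleZeroProductBlow

/-!
# Stub `stub_rebaseSimplePosOneZero` (crux `ArrangementNormalForm`, line `janus-bands`) —
part `CornerNorm`: coordinates over the base `(x, y)` and the normalising base change

Corner toolkit for the double-corner bands at `B = 1` (base `(x, y) ∈ ℝ²`, one lettered fibre
`t`), first file. The literal one-fibre datum `[{rows(x, y) > 0, u < t < v}, R(x)/(y − ℓ₂(x)) · 1/t]`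
(`glit 1 1 p L e ℓ₁ ℓ₂ 0 1 (some 0)`, `R = p/∏ Lⱼ^{eⱼ}`) is moved by the rational affine base
change `x = x₀ + σ x'`, `y = ℓ₂(x) + τ y'`, `t = t'` (`σ, τ = ±1`, rule 2, Jacobian `1`) to the
literal datum with pole line `y' = 0` (`ℓ₂ = 0`), numerator `τ · p(x₀ + σ X)`, silent factors
`Lⱼ(x₀ + σ X)` and rows / bounds composed with the map (`RebasePos.normF`):
`RebasePos.cornerNormalize`. This puts a corner `(x₀, ℓ₂(x₀))` of a double-corner band at the
origin with the base cell in a chosen quadrant. Also: the coordinate dictionary `affF_two`,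
`affB_two`, `glit_two` for `B = 1`, and the rule-2 packaging `RebaseZero.cov_pull` re-exported
for literal one-fibre data (`RebasePos.cov_glit`).

References: M. Kontsevich, D. Zagier, *Periods* (2001), §1.2, rule (2).
-/

noncomputable section

open Set MeasureTheory MvPolynomial
open Literature.NumberTheory.Transcendental Literature.ModelTheory.ExponentialFields

namespace Summit.KontsevichZagierPeriods.ArrangementNormalForm.JanusBands

namespace RebasePos

open SeparatePos

section Coord

/-- The `x`-slot of `ℝ³ = ℝ^{1+1+1}`. -/
theorem ix_eq : (Fin.castAdd 1 (Fin.castSucc (0 : Fin 1)) : Fin (1 + 1 + 1)) = 0 := rfl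

/-- The `y`-slot of `ℝ³`. -/
theorem iy_eq : (Fin.castAdd 1 (Fin.last 1) : Fin (1 + 1 + 1)) = 1 := rfl

/-- The `t`-slot of `ℝ³`. -/
theorem it_eq : (Fin.natAdd (1 + 1) (0 : Fin 1) : Fin (1 + 1 + 1)) = 2 := rfl

/-- A generic base slot of `ℝ³`. -/
theorem ib_eq (i : Fin (1 + 1)) : (Fin.castAdd 1 i : Fin (1 + 1 + 1)) = ⟨i.1, by omega⟩ := rfl

/-- Full-base affine forms over `(x, y)` in coordinates. -/
theorem affF_two (c : (Fin (1 + 1) → ℚ) × ℚ) (z : Fin (1 + 1 + 1) → ℝ) :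
    affF 1 1 c z = (c.1 0 : ℝ) * z 0 + (c.1 1 : ℝ) * z 1 + (c.2 : ℝ) := by
  simp [affF, Fin.sum_univ_two]

/-- Silent affine forms over `x` in coordinates. -/
theorem affB_two (d : (Fin 1 → ℚ) × ℚ) (z : Fin (1 + 1 + 1) → ℝ) :
    affB 1 1 d z = (d.1 0 : ℝ) * z 0 + (d.2 : ℝ) := by
  simp [affB]

/-- The literal one-fibre integrand with a simple base pole and the letter `0`, in coordinates:
`R(x)/(y − ℓ₂(x)) · 1/t`. -/
theorem glit_two {m : ℕ} (p : MvPolynomial (Fin 1) ℚ) (L : Fin m → (Fin 1 → ℚ) × ℚ) (e : Fin m → ℕ)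
    (ℓ₁ ℓ₂ : (Fin 1 → ℚ) × ℚ) (z : Fin (1 + 1 + 1) → ℝ) :
    glit 1 1 p L e ℓ₁ ℓ₂ 0 1 (fun _ => some 0) z =
      MvPolynomial.aeval (fun _ : Fin 1 => z 0) p / (∏ j, (affB 1 1 (L j) z) ^ e j) *
        (1 / (z 1 - affB 1 1 ℓ₂ z)) * (1 / z 2) := by
  have hx : (fun i : Fin 1 => z (Fin.castAdd 1 (Fin.castSucc i))) = fun _ => z 0 :=
    funext fun i => by rw [Subsingleton.elim i 0]; rfl
  rw [glit_one, hx]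
  simp only [pow_zero, pow_one, affF_zero'', sub_zero, iy_eq, it_eq, one_div]

/-- A point of `ℝ³` from its three coordinates. -/
theorem vec3_eq (z : Fin (1 + 1 + 1) → ℝ) : (![z 0, z 1, z 2] : Fin (1 + 1 + 1) → ℝ) = z := by
  funext l
  fin_cases l <;> rfl

end Coord

section Cov

variable {m m' : ℕ}

/-- **Rule 2 for literal one-fibre data** (`RebaseZero.cov_pull` repackaged): a semialgebraic,
injective, differentiable map `Ψ` of the literal domain `R = {rows, U < t < V}` ONTO `s.domain`
under which `s.integrand ∘ Ψ · |det Ψ'|` is the literal integrand `f'` on `R` yields a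
representation `s' = [R, f']` with `[s] − [s'] ∈ KZ.relations`. -/
theorem cov_glit (s : KZ.IntegralRep (1 + 1 + 1)) (M : Fin m' → (Fin (1 + 1) → ℚ) × ℚ)
    (U V : (Fin (1 + 1) → ℚ) × ℚ) (p : MvPolynomial (Fin 1) ℚ) (L : Fin m → (Fin 1 → ℚ) × ℚ)
    (e : Fin m → ℕ) (ℓ₁ ℓ₂ : (Fin 1 → ℚ) × ℚ) (n₁ n₂ : ℕ)
    (Ψ : (Fin (1 + 1 + 1) → ℝ) → (Fin (1 + 1 + 1) → ℝ))
    (Ψ' : (Fin (1 + 1 + 1) → ℝ) → (Fin (1 + 1 + 1) → ℝ) →L[ℝ] (Fin (1 + 1 + 1) → ℝ))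
    (hsa : IsSemialgebraicMapOn ℚ (gDom 1 1 m' M (fun _ => Sum.inr U) (fun _ => Sum.inr V)) Ψ)
    (hder : ∀ w ∈ gDom 1 1 m' M (fun _ => Sum.inr U) (fun _ => Sum.inr V), HasFDerivAt Ψ (Ψ' w) w)
    (hinj : InjOn Ψ (gDom 1 1 m' M (fun _ => Sum.inr U) (fun _ => Sum.inr V)))
    (himg : Ψ '' gDom 1 1 m' M (fun _ => Sum.inr U) (fun _ => Sum.inr V) = s.domain)
    (hf : ∀ w ∈ gDom 1 1 m' M (fun _ => Sum.inr U) (fun _ => Sum.inr V),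
      glit 1 1 p L e ℓ₁ ℓ₂ n₁ n₂ (fun _ => some 0) w = s.integrand (Ψ w) * |(Ψ' w).det|) :
    ∃ s' : KZ.IntegralRep (1 + 1 + 1),
      s'.domain = gDom 1 1 m' M (fun _ => Sum.inr U) (fun _ => Sum.inr V) ∧
      s'.integrand = glit 1 1 p L e ℓ₁ ℓ₂ n₁ n₂ (fun _ => some 0) ∧
      KZ.of s - KZ.of s' ∈ KZ.relations :=
  RebaseZero.cov_pull s (isSemialgebraic_gDom _ _ _ _) Ψ Ψ' hsa
    (fun w hw => (hder w hw).hasFDerivWithinAt) hinj himg _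
    (isSemialgebraicFunOn_glit (isSemialgebraic_gDom _ _ _ _) _ _ _ _ _ _ _ _) hf

end Cov

section Norm

variable (x₀ σ τ : ℚ) (ℓ₂ : (Fin 1 → ℚ) × ℚ)

/-- The normalising base change `(x', y', t) ↦ (x₀ + σ x', ℓ₂(x₀ + σ x') + τ y', t)`. -/
def normMap (w : Fin (1 + 1 + 1) → ℝ) : Fin (1 + 1 + 1) → ℝ :=
  ![(x₀ : ℝ) + σ * w 0, (ℓ₂.1 0 : ℝ) * (x₀ + σ * w 0) + ℓ₂.2 + τ * w 1, w 2]

/-- Its inverse `(x, y, t) ↦ (σ (x − x₀), τ (y − ℓ₂(x)), t)` (for `σ² = τ² = 1`). -/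
def normInv (z : Fin (1 + 1 + 1) → ℝ) : Fin (1 + 1 + 1) → ℝ :=
  ![(σ : ℝ) * (z 0 - x₀), (τ : ℝ) * (z 1 - ((ℓ₂.1 0 : ℝ) * z 0 + ℓ₂.2)), z 2]

/-- A full-base affine form composed with `normMap`. -/
def normF (c : (Fin (1 + 1) → ℚ) × ℚ) : (Fin (1 + 1) → ℚ) × ℚ :=
  (![σ * (c.1 0 + ℓ₂.1 0 * c.1 1), τ * c.1 1], c.1 0 * x₀ + c.1 1 * (ℓ₂.1 0 * x₀ + ℓ₂.2) + c.2)

/-- A silent affine form composed with `normMap`. -/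
def normL (d : (Fin 1 → ℚ) × ℚ) : (Fin 1 → ℚ) × ℚ := (fun _ => σ * d.1 0, d.1 0 * x₀ + d.2)

/-- The numerator after `normMap`: `τ · p(x₀ + σ X)`. -/
def normP (p : MvPolynomial (Fin 1) ℚ) : MvPolynomial (Fin 1) ℚ :=
  MvPolynomial.C τ * MvPolynomial.bind₁ (fun _ : Fin 1 => MvPolynomial.C x₀ + MvPolynomial.C σ * X 0) p

/-- The linear part of `normMap`. -/
def normMat : Matrix (Fin (1 + 1 + 1)) (Fin (1 + 1 + 1)) ℝ :=
  !![(σ : ℝ), 0, 0; (ℓ₂.1 0 : ℝ) * σ, τ, 0; 0, 0, 1]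

/-- The linear part of `normMap` as a continuous linear map. -/
def normLin : (Fin (1 + 1 + 1) → ℝ) →L[ℝ] (Fin (1 + 1 + 1) → ℝ) :=
  LinearMap.toContinuousLinearMap (Matrix.toLin' (normMat σ τ ℓ₂))

/-- `normMap` on the `x`-slot. -/
@[simp] theorem normMap_zero (w : Fin (1 + 1 + 1) → ℝ) : normMap x₀ σ τ ℓ₂ w 0 = (x₀ : ℝ) + σ * w 0 := rfl

/-- `normMap` on the `y`-slot. -/
@[simp] theorem normMap_one (w : Fin (1 + 1 + 1) → ℝ) :
    normMap x₀ σ τ ℓ₂ w 1 = (ℓ₂.1 0 : ℝ) * (x₀ + σ * w 0) + ℓ₂.2 + τ * w 1 := rfl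

/-- `normMap` on the `t`-slot. -/
@[simp] theorem normMap_two (w : Fin (1 + 1 + 1) → ℝ) : normMap x₀ σ τ ℓ₂ w 2 = w 2 := rfl

/-- **Key identity**: forms compose with `normMap` via `normF`. -/
theorem affF_normF (c : (Fin (1 + 1) → ℚ) × ℚ) (w : Fin (1 + 1 + 1) → ℝ) :
    affF 1 1 (normF x₀ σ τ ℓ₂ c) w = affF 1 1 c (normMap x₀ σ τ ℓ₂ w) := by
  simp only [affF_two, normF, normMap_zero, normMap_one, Matrix.cons_val_zero, Matrix.cons_val_one]
  push_cast
  ring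

/-- Silent forms compose with `normMap` via `normL`. -/
theorem affB_normL (d : (Fin 1 → ℚ) × ℚ) (w : Fin (1 + 1 + 1) → ℝ) :
    affB 1 1 (normL x₀ σ d) w = affB 1 1 d (normMap x₀ σ τ ℓ₂ w) := by
  simp only [affB_two, normL, normMap_zero]
  push_cast
  ring

/-- The numerator composes with `normMap` via `normP`. -/
theorem aeval_normP (p : MvPolynomial (Fin 1) ℚ) (w : Fin (1 + 1 + 1) → ℝ) :
    MvPolynomial.aeval (fun _ : Fin 1 => w 0) (normP x₀ σ τ p) =
      (τ : ℝ) * MvPolynomial.aeval (fun _ : Fin 1 => normMap x₀ σ τ ℓ₂ w 0) p := by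
  have hF : (fun i : Fin 1 => MvPolynomial.aeval (fun _ : Fin 1 => w 0)
      (MvPolynomial.C x₀ + MvPolynomial.C σ * X 0 : MvPolynomial (Fin 1) ℚ)) =
      fun _ => normMap x₀ σ τ ℓ₂ w 0 := by
    funext i
    simp
  rw [normP, map_mul, MvPolynomial.aeval_C, MvPolynomial.aeval_bind₁, eq_ratCast, hF]

/-- `normF` is additive. -/
theorem normF_sub (c c' : (Fin (1 + 1) → ℚ) × ℚ) :
    normF x₀ σ τ ℓ₂ (c - c') = normF x₀ σ τ ℓ₂ c - normF x₀ σ τ ℓ₂ c' := by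
  refine Prod.ext (funext fun i => ?_) ?_
  · fin_cases i <;> simp [normF] <;> ring
  · simp [normF]; ring

/-- `normF` is homogeneous. -/
theorem normF_smul (A : ℚ) (c : (Fin (1 + 1) → ℚ) × ℚ) :
    normF x₀ σ τ ℓ₂ (A • c) = A • normF x₀ σ τ ℓ₂ c := by
  refine Prod.ext (funext fun i => ?_) ?_
  · fin_cases i <;> simp [normF] <;> ring
  · simp [normF]; ring

/-- The `y`-coefficient of `normF c` is `τ` times that of `c`. -/
theorem normF_last (c : (Fin (1 + 1) → ℚ) × ℚ) : (normF x₀ σ τ ℓ₂ c).1 (Fin.last 1) = τ * c.1 (Fin.last 1) := by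
  simp [normF]

end Norm

section NormMove

variable (x₀ σ τ : ℚ) (ℓ₂ : (Fin 1 → ℚ) × ℚ) {m m' : ℕ}

/-- `normLin` in coordinates. -/
theorem normLin_apply (v : Fin (1 + 1 + 1) → ℝ) :
    normLin σ τ ℓ₂ v = ![(σ : ℝ) * v 0, (ℓ₂.1 0 : ℝ) * σ * v 0 + τ * v 1, v 2] := by
  rw [normLin, LinearMap.coe_toContinuousLinearMap', Matrix.toLin'_apply]
  funext l
  fin_cases l <;> simp [normMat, Matrix.mulVec, dotProduct, Fin.sum_univ_three]

/-- `normMap` is the affine map `normLin + const`. -/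
theorem normMap_eq (w : Fin (1 + 1 + 1) → ℝ) :
    normMap x₀ σ τ ℓ₂ w = normLin σ τ ℓ₂ w + ![(x₀ : ℝ), (ℓ₂.1 0 : ℝ) * x₀ + ℓ₂.2, 0] := by
  rw [normLin_apply]
  funext l
  fin_cases l <;> simp [normMap] <;> ring

/-- `normMap` has derivative `normLin`. -/
theorem hasFDerivAt_normMap (w : Fin (1 + 1 + 1) → ℝ) :
    HasFDerivAt (normMap x₀ σ τ ℓ₂) (normLin σ τ ℓ₂) w := by
  have h : normMap x₀ σ τ ℓ₂ = fun w => normLin σ τ ℓ₂ w + ![(x₀ : ℝ), (ℓ₂.1 0 : ℝ) * x₀ + ℓ₂.2, 0] :=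
    funext (normMap_eq x₀ σ τ ℓ₂)
  rw [h]
  exact (normLin σ τ ℓ₂).hasFDerivAt.add_const _

/-- The Jacobian determinant of `normMap` is `σ τ`. -/
theorem normLin_det : (normLin σ τ ℓ₂).det = (σ : ℝ) * τ := by
  rw [normLin, ContinuousLinearMap.det, LinearMap.coe_toContinuousLinearMap, LinearMap.det_toLin',
    normMat, Matrix.det_fin_three]
  simp

/-- `normInv ∘ normMap = id`. -/
theorem normInv_normMap (hσ : σ * σ = 1) (hτ : τ * τ = 1) (w : Fin (1 + 1 + 1) → ℝ) :
    normInv x₀ σ τ ℓ₂ (normMap x₀ σ τ ℓ₂ w) = w := by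
  have hσ' : (σ : ℝ) * σ = 1 := by exact_mod_cast hσ
  have hτ' : (τ : ℝ) * τ = 1 := by exact_mod_cast hτ
  funext l
  fin_cases l
  · simp only [normInv, normMap_zero, Fin.zero_eta, Matrix.cons_val_zero]
    linear_combination (w 0) * hσ'
  · simp only [normInv, normMap_zero, normMap_one, Fin.mk_one, Matrix.cons_val_one, Matrix.cons_val_zero]
    linear_combination (w 1) * hτ'
  · rfl

/-- `normMap ∘ normInv = id`. -/
theorem normMap_normInv (hσ : σ * σ = 1) (hτ : τ * τ = 1) (z : Fin (1 + 1 + 1) → ℝ) :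
    normMap x₀ σ τ ℓ₂ (normInv x₀ σ τ ℓ₂ z) = z := by
  have hσ' : (σ : ℝ) * σ = 1 := by exact_mod_cast hσ
  have hτ' : (τ : ℝ) * τ = 1 := by exact_mod_cast hτ
  funext l
  fin_cases l
  · simp only [normMap, normInv, Fin.zero_eta, Matrix.cons_val_zero]
    linear_combination (z 0 - x₀) * hσ'
  · simp only [normMap, normInv, Fin.mk_one, Matrix.cons_val_one, Matrix.cons_val_zero]
    linear_combination (z 1 - ((ℓ₂.1 0 : ℝ) * z 0 + ℓ₂.2)) * hτ' + (ℓ₂.1 0 : ℝ) * (z 0 - x₀) * hσ'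
  · rfl

/-- `normInv` is continuous. -/
theorem continuous_normInv : Continuous (normInv x₀ σ τ ℓ₂) := by
  refine continuous_pi fun l => ?_
  fin_cases l <;> simp only [normInv, Fin.zero_eta, Fin.mk_one, Fin.reduceFinMk, Matrix.cons_val_zero,
    Matrix.cons_val_one, Matrix.cons_val] <;> fun_prop

/-- `normMap` as a polynomial map. -/
def normPoly : Fin (1 + 1 + 1) → MvPolynomial (Fin (1 + 1 + 1)) ℚ :=
  ![MvPolynomial.C x₀ + MvPolynomial.C σ * X 0,
    MvPolynomial.C (ℓ₂.1 0) * (MvPolynomial.C x₀ + MvPolynomial.C σ * X 0) + MvPolynomial.C ℓ₂.2 +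
      MvPolynomial.C τ * X 1, X 2]

/-- `normPoly` evaluates to `normMap`. -/
theorem aeval_normPoly (w : Fin (1 + 1 + 1) → ℝ) :
    (fun l => MvPolynomial.aeval w (normPoly x₀ σ τ ℓ₂ l)) = normMap x₀ σ τ ℓ₂ w := by
  funext l
  fin_cases l <;> simp [normPoly, normMap]

/-- **The normalising base change** (rule 2, Jacobian `|σ τ| = 1`). A literal one-fibre datum
over the base `(x, y)` with base pole `y = ℓ₂(x)` and letter `0` is moved by
`x = x₀ + σ x'`, `y = ℓ₂(x) + τ y'` to the literal datum with base pole `y' = 0`, numerator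
`τ p(x₀ + σ X)`, silent factors `Lⱼ(x₀ + σ X)` and rows / bounds `normF`. -/
theorem cornerNormalize (hσ : σ * σ = 1) (hτ : τ * τ = 1) (s : KZ.IntegralRep (1 + 1 + 1))
    (M : Fin m' → (Fin (1 + 1) → ℚ) × ℚ) (L : Fin m → (Fin 1 → ℚ) × ℚ) (e : Fin m → ℕ)
    (p : MvPolynomial (Fin 1) ℚ) (ℓ₁ : (Fin 1 → ℚ) × ℚ) (u v : (Fin (1 + 1) → ℚ) × ℚ)
    (hbd : Bornology.IsBounded s.domain)
    (hdom : s.domain = gDom 1 1 m' M (fun _ => Sum.inr u) (fun _ => Sum.inr v))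
    (hint : EqOn s.integrand (glit 1 1 p L e ℓ₁ ℓ₂ 0 1 (fun _ => some 0)) s.domain) :
    ∃ s' : KZ.IntegralRep (1 + 1 + 1), Bornology.IsBounded s'.domain ∧
      s'.domain = gDom 1 1 m' (fun j => normF x₀ σ τ ℓ₂ (M j)) (fun _ => Sum.inr (normF x₀ σ τ ℓ₂ u))
        (fun _ => Sum.inr (normF x₀ σ τ ℓ₂ v)) ∧
      EqOn s'.integrand (glit 1 1 (normP x₀ σ τ p) (fun j => normL x₀ σ (L j)) e ℓ₁ 0 0 1
        (fun _ => some 0)) s'.domain ∧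
      (∀ w, w ∈ s'.domain ↔ normMap x₀ σ τ ℓ₂ w ∈ s.domain) ∧
      KZ.of s - KZ.of s' ∈ KZ.relations := by
  set R := gDom 1 1 m' (fun j => normF x₀ σ τ ℓ₂ (M j)) (fun _ => Sum.inr (normF x₀ σ τ ℓ₂ u))
    (fun _ => Sum.inr (normF x₀ σ τ ℓ₂ v)) with hR
  have hτ' : (τ : ℝ) * τ = 1 := by exact_mod_cast hτ
  -- membership
  have hΨdom : ∀ w, w ∈ R ↔ normMap x₀ σ τ ℓ₂ w ∈ s.domain := fun w => by
    rw [hR, mem_gDom_one, hdom, mem_gDom_one]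
    simp only [affF_normF, it_eq, normMap_two]
  have himg : normMap x₀ σ τ ℓ₂ '' R = s.domain := by
    ext z
    constructor
    · rintro ⟨w, hw, rfl⟩
      exact (hΨdom w).1 hw
    · intro hz
      exact ⟨normInv x₀ σ τ ℓ₂ z, (hΨdom _).2 (by rw [normMap_normInv x₀ σ τ ℓ₂ hσ hτ]; exact hz),
        normMap_normInv x₀ σ τ ℓ₂ hσ hτ z⟩
  have hinj : InjOn (normMap x₀ σ τ ℓ₂) R := fun w _ w' _ h => by
    rw [← normInv_normMap x₀ σ τ ℓ₂ hσ hτ w, h, normInv_normMap x₀ σ τ ℓ₂ hσ hτ]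
  -- the integrand identity
  have hdet : |(normLin σ τ ℓ₂).det| = 1 := by
    have hσ' : (σ : ℝ) * σ = 1 := by exact_mod_cast hσ
    have h1 : |(σ : ℝ)| = 1 :=
      (pow_eq_one_iff_of_nonneg (abs_nonneg _) two_ne_zero).1 (by rw [pow_two, ← abs_mul, hσ', abs_one])
    have h2 : |(τ : ℝ)| = 1 :=
      (pow_eq_one_iff_of_nonneg (abs_nonneg _) two_ne_zero).1 (by rw [pow_two, ← abs_mul, hτ', abs_one])
    rw [normLin_det, abs_mul, h1, h2, mul_one]
  have hf : ∀ w ∈ R, glit 1 1 (normP x₀ σ τ p) (fun j => normL x₀ σ (L j)) e ℓ₁ 0 0 1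
      (fun _ => some 0) w = s.integrand (normMap x₀ σ τ ℓ₂ w) * |(normLin σ τ ℓ₂).det| := by
    intro w hw
    have hτinv : (τ : ℝ)⁻¹ = τ := inv_eq_of_mul_eq_one_left hτ'
    rw [hint ((hΨdom w).1 hw), hdet, mul_one, glit_two, glit_two, aeval_normP x₀ σ τ ℓ₂]
    simp only [affB_normL x₀ σ τ ℓ₂, normMap_zero, normMap_one, normMap_two, affB_two, Prod.fst_zero,
      Pi.zero_apply, Prod.snd_zero, Rat.cast_zero, zero_mul, add_zero, sub_zero]
    have key : (ℓ₂.1 0 : ℝ) * (x₀ + σ * w 0) + ℓ₂.2 + τ * w 1 - ((ℓ₂.1 0 : ℝ) * (x₀ + σ * w 0) + ℓ₂.2) =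
        τ * w 1 := by ring
    rw [key, one_div ((τ : ℝ) * w 1), mul_inv_rev, hτinv]
    ring
  have hRsa : IsSemialgebraic ℚ R := isSemialgebraic_gDom _ _ _ _
  have hsa : IsSemialgebraicMapOn ℚ R (normMap x₀ σ τ ℓ₂) :=
    (isSemialgebraicMapOn_aeval hRsa (normPoly x₀ σ τ ℓ₂)).congr fun w _ => aeval_normPoly x₀ σ τ ℓ₂ w
  obtain ⟨s', hd', hi', hrel⟩ := cov_glit s _ _ _ (normP x₀ σ τ p) (fun j => normL x₀ σ (L j)) e ℓ₁ 0
    0 1 (normMap x₀ σ τ ℓ₂) (fun _ => normLin σ τ ℓ₂) hsa (fun w _ => hasFDerivAt_normMap x₀ σ τ ℓ₂ w)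
    hinj himg hf
  refine ⟨s', ?_, hd', fun w _ => by rw [hi'], fun w => by rw [hd']; exact hΨdom w, hrel⟩
  rw [hd']
  refine ((hbd.isCompact_closure.image (continuous_normInv x₀ σ τ ℓ₂)).isBounded).subset fun w hw => ?_
  exact ⟨normMap x₀ σ τ ℓ₂ w, subset_closure ((hΨdom w).1 hw), normInv_normMap x₀ σ τ ℓ₂ hσ hτ w⟩

end NormMove

end RebasePos

/-- **Registered part of `stub_rebaseSimplePosOneZero` (line `janus-bands`): the normalising base
change of the corner toolkit** (`RebasePos.cornerNormalize`, rule 2 with Jacobian `1`): a literal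
one-fibre datum over the base `(x, y)` with base pole `y = ℓ₂(x)` and letter `0` is congruent
modulo `KZ.relations` to the literal datum obtained by `x = x₀ + σ x'`, `y = ℓ₂(x) + τ y'`
(`σ² = τ² = 1`), whose base pole is `y' = 0`. -/
theorem rebaseSimplePos_cornerNormalize (x₀ σ τ : ℚ) (ℓ₂ : (Fin 1 → ℚ) × ℚ) (m m' : ℕ) (hσ : σ * σ = 1) (hτ : τ * τ = 1) (s : KZ.IntegralRep (1 + 1 + 1)) (M : Fin m' → (Fin (1 + 1) → ℚ) × ℚ) (L : Fin m → (Fin 1 → ℚ) × ℚ) (e : Fin m → ℕ) (p : MvPolynomial (Fin 1) ℚ) (ℓ₁ : (Fin 1 → ℚ) × ℚ) (u v : (Fin (1 + 1) → ℚ) × ℚ) (hbd : Bornology.IsBounded s.domain) (hdom : s.domain = SeparatePos.gDom 1 1 m' M (fun _ => Sum.inr u) (fun _ => Sum.inr v)) (hint : EqOn s.integrand (RebasePos.glit 1 1 p L e ℓ₁ ℓ₂ 0 1 (fun _ => some 0)) s.domain) : ∃ s' : KZ.IntegralRep (1 + 1 + 1), Bornology.IsBounded s'.domain ∧ s'.domain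 = SeparatePos.gDom 1 1 m' (fun j => RebasePos.normF x₀ σ τ ℓ₂ (M j)) (fun _ => Sum.inr (RebasePos.normF x₀ σ τ ℓ₂ u)) (fun _ => Sum.inr (RebasePos.normF x₀ σ τ ℓ₂ v)) ∧ EqOn s'.integrand (RebasePos.glit 1 1 (RebasePos.normP x₀ σ τ p) (fun j => RebasePos.normL x₀ σ (L j)) e ℓ₁ 0 0 1 (fun _ => some 0)) s'.domain ∧ (∀ w, w ∈ s'.domain ↔ RebasePos.normMap x₀ σ τ ℓ₂ w ∈ s.domain) ∧ KZ.of s - KZ.of s' ∈ KZ.relations :=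
  RebasePos.cornerNormalize x₀ σ τ ℓ₂ hσ hτ s M L e p ℓ₁ u v hbd hdom hint

end Summit.KontsevichZagierPeriods.ArrangementNormalForm.JanusBands
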